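import Summits.QuantumFields.BalabanUV.Beta.EriceRemainderEnclosureHistoryAutonomyComparisonAgeCompositionThreeAgesDefectAbs
import Summits.QuantumFields.BalabanUV.Beta.EriceRemainderEnclosureHistoryAutonomyComparisonAgeCompositionDecayBudget
import Mathlib.Analysis.Convex.SpecificFunctions.Basic
import Mathlib.Analysis.Convex.Jensen

/-!
# EriceRemainderEnclosureHistoryAutonomyComparisonAgeCompositionThreeAgesDefectGeomBudget — (E88c) route (N), first order, THREE loaded ages: the B-FORM
# of (E88b) (hence (★h°[gU]) of (E88a)) FROM ONE ADDITIVE BUDGET — the logarithm of the B-form is additive in the level log-steps, the loads and the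
# levels-and-loads minorants except for the single letter `log(k₃·(1 − r·gU₁))`; each piece below its linearisation ((E84b) `cube_le_exp` for the young decay,
# `log(1+F) ≤ F` for the floors, the arithmetic–geometric mean for the young floor rows)

Cell `pub-balaban`, β-function sub-cell, BINDER row D4 «RemainderConst leaves for Bałaban's split» (`HOME/BINDER-OWNERS.md`; owner lineage `b2b-balaban-beta-an4`;
this file by co-owner #2 lineage `b2b-balaban-beta-d4-p2`, generation 79), β-FLOW TEAM duty (1), FREEZE (0) honoured (def-free; imports (E87p), (E84b) (uses
`cube_le_exp` BY NAME) and Mathlib's Jensen inequality; nothing restated).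

HONEST FRAMING (page 1, verbatim and binding).  *"Discharging BetaPertH makes Bałaban's UV stability UNCONDITIONAL — a real constructive-QFT result; it is
NOT the continuum limit and NOT the Clay problem."*  THIS FILE DISCHARGES NOTHING OF THE KIND.  Elementary real analysis about displayed letters (positive
sequences, non-negative loads) — hypotheses of a census, not facts; the form, signs, ages and moments of Bałaban's (1.22) limit functional are NOT PRINTED ([I]
p. 298; GAPS G-t4-U2-1∕-2) and NOT asserted.  Row D4 class UNCHANGED (critical-path width 0; instance 0∕1; D4 DISCHARGE NO DATE).  HONEST DEPENDENCY:
continuum YM on T⁴ ⇐ BetaPertH ∧ nine spine estimates (0/9 proved); BetaPertH ⇐ (D1) ∧ (D4) ∧ CAP+tail; G-an2-4 gates asym, D1 and NE2/3/4.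

THE POINT (census sense (α); route (N); README `HOME/b2b-balaban-beta-d4-p2/g79/e88/README.md` §3–§4).  **`geom_of_linear_budget`**: at a pin `m` and a
truncation `j ≥ m+1+k₃`, with `n₀ = m+1+k₃`, `r = (h_{m+k₃+1}∕h_{m+k₃})³`, `gU₁ = gU_{m+k₃+1}`, the young coefficient `q_n = L_{k₂}h_{n+k₂}³∕2`, loads `F ≥ 0`,
floors `Pf(a,b) = (Π_{t∈[a,b]}(1+F_t))⁻¹`, young floor rows `ALa_j(p) = q_p·Σ_{l<k₂}[p+1+l ≤ j]·Pf(p+1+l,p+k₂)·τlo(p+1+l)` (`τlo ≥ 0`), row lag counts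
`1 ≤ N_{l'} ≤ k₂` inside the truncation (`m+1+l'+N_{l'} ≤ j`) with `τlo > 0` on the lags used, level steps `y_p = 1 − (h_{p+1}∕h_p)²`: IF THE B-BUDGET
`log(r·gU₁) + log(Σ_{l<k₂}[m+2+k₃+l ≤ j]·Π gU) ≤ log(k₃(1 − r·gU₁)) + (1∕k₃)·Σ_{l'<k₃} [ −Σ_{t∈[m+1+l',m+k₃]} F_t + Σ_{p∈[m+1+l'+k₂, m+k₃+k₂]} (3∕2)(y_p + y_p²∕2)
+ log N_{l'} + (1∕N_{l'})·Σ_{l<N_{l'}} ( −Σ_{t∈[m+2+l'+l, m+1+l'+k₂]} F_t + log τlo(m+2+l'+l) ) ]` holds, THEN the B-form of (E88b) holds at `(m, j)`: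
`r·gU₁·q_{n₀}·Σ_{l<k₂}[⋯]·Π gU ≤ (1 − r·gU₁)·k₃·exp((1∕k₃)·Σ_{l'<k₃} log(Pf(m+1+l',m+k₃)·ALa_j(m+1+l')))`.  After exchanging the sums the budget weighs the
level step at `m+1+k₂+i` and the floor at `m+1+i` by `(i+1)∕k₃` — the early scales, where the young age's load sits in the infrared corner, LIGHTLY — which is
why it stays k-uniform where (★h°), v5 and the Jensen mean over all `k₃+1` terms do not (README §3: corner margin `0.247∕0.221∕0.207∕0.200∕0.196∕0.195` at
`k₃ = 32…1024`; affine census grid: kit j336918).  NOT CLAIMED: the budget along flows (successor: domination reads for `y_p` with THREE ratios, caps for `τlo`,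
a tangent bound for `log(k₃(1 − r·gU₁))`, certificates); anything nonlinear; anything printed — NOT B12 Thm 2, NOT BetaPertH.

WHAT IS PROVED ([folklore]; 0 `def`, 0 sorry).  §1 `log_card_add_mean_log_le` (AM–GM in logarithms), `log_inv_prod_ge`, `three_log_ratio_le`, `log_ratio_cube_ge`;
§2 **`geom_of_linear_budget`**.
-/
noncomputable section
open Finset

namespace Summit.QuantumFields.BalabanUV.Beta.EriceRemainderEnclosureHistoryAutonomyComparisonAgeCompositionThreeAgesDefectGeomBudget

open Summit.QuantumFields.BalabanUV.Beta.EriceRemainderEnclosureHistoryAutonomyComparisonAgeCompositionDecayBudget (cube_le_exp)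

/-! ## §1 Logarithmic pieces -/

/-- **AM–GM in logarithms**: for positive `x_0,…,x_{n−1}` (`n ≥ 1`), `log n + (Σ_{l<n} log x_l)∕n ≤ log(Σ_{l<n} x_l)` (Jensen for `exp`). [folklore] -/
theorem log_card_add_mean_log_le {n : ℕ} (hn : 1 ≤ n) {x : ℕ → ℝ} (hx : ∀ l ∈ range n, 0 < x l) :
    Real.log n + (∑ l ∈ range n, Real.log (x l)) / n ≤ Real.log (∑ l ∈ range n, x l) := by
  have hn0 : (0 : ℝ) < n := by exact_mod_cast (show 0 < n by omega)
  have hJ := (convexOn_exp).map_sum_le (t := range n) (w := fun _ => (1 : ℝ) / n) (p := fun l => Real.log (x l))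
    (fun _ _ => by positivity) (by rw [sum_const, card_range, nsmul_eq_mul]; field_simp) (fun _ _ => Set.mem_univ _)
  simp only [smul_eq_mul] at hJ
  have e1 : ∑ l ∈ range n, 1 / (n : ℝ) * Real.log (x l) = (∑ l ∈ range n, Real.log (x l)) / n := by rw [← mul_sum]; ring
  have e2 : ∑ l ∈ range n, 1 / (n : ℝ) * Real.exp (Real.log (x l)) = (∑ l ∈ range n, x l) / n := by
    rw [← mul_sum, sum_congr rfl fun l hl => Real.exp_log (hx l hl)]; ring
  rw [e1, e2] at hJ
  have hS : 0 < ∑ l ∈ range n, x l := sum_pos hx (by rw [nonempty_range_iff]; omega)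
  have h1 : Real.exp ((∑ l ∈ range n, Real.log (x l)) / n) * n ≤ ∑ l ∈ range n, x l := by rwa [le_div_iff₀ hn0] at hJ
  have h2 := Real.log_le_log (by positivity) h1
  rwa [Real.log_mul (Real.exp_pos _).ne' hn0.ne', Real.log_exp, add_comm] at h2

/-- Floors below their exponential: `−Σ_{t∈s} F_t ≤ log((Π_{t∈s}(1+F_t))⁻¹)` for `F ≥ 0` (`log(1+F) ≤ F`). [folklore] -/
theorem log_inv_prod_ge {F : ℕ → ℝ} (hF0 : ∀ t, 0 ≤ F t) (s : Finset ℕ) :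
    -∑ t ∈ s, F t ≤ Real.log ((∏ t ∈ s, (1 + F t))⁻¹) := by
  rw [Real.log_inv, Real.log_prod (fun t _ => by have := hF0 t; positivity), neg_le_neg_iff]
  exact sum_le_sum fun t _ => by
    have h1 : 1 + F t ≤ Real.exp (F t) := by linarith [Real.add_one_le_exp (F t)]
    have := Real.log_le_log (by linarith [hF0 t]) h1
    rwa [Real.log_exp] at this

/-- One level step in logarithms: `3·log(h_{p+1}∕h_p) ≤ −(3∕2)(y_p + y_p²∕2)`, `y_p = 1 − (h_{p+1}∕h_p)²` ((E84b) `cube_le_exp`). [folklore] -/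
theorem three_log_ratio_le {h : ℕ → ℝ} (hpos : ∀ n, 0 < h n) (hanti : Antitone h) (p : ℕ) :
    3 * Real.log (h (p + 1) / h p) ≤ -(3 / 2 * ((1 - (h (p + 1) / h p) ^ 2) + (1 - (h (p + 1) / h p) ^ 2) ^ 2 / 2)) := by
  have ht0 : 0 < h (p + 1) / h p := div_pos (hpos _) (hpos _)
  have ht1 : h (p + 1) / h p ≤ 1 := (div_le_one (hpos p)).mpr (hanti (Nat.le_succ p))
  have h1 := Real.log_le_log (pow_pos ht0 3) (cube_le_exp ht0 ht1)
  rwa [Real.log_exp, Real.log_pow, Nat.cast_ofNat] at h1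

/-- The young decay across a window in logarithms: `Σ_{p∈[a,a+n)} (3∕2)(y_p + y_p²∕2) ≤ 3·log(h_a∕h_{a+n})`. [folklore] -/
theorem log_ratio_cube_ge {h : ℕ → ℝ} (hpos : ∀ n, 0 < h n) (hanti : Antitone h) (a n : ℕ) :
    ∑ p ∈ Ico a (a + n), 3 / 2 * ((1 - (h (p + 1) / h p) ^ 2) + (1 - (h (p + 1) / h p) ^ 2) ^ 2 / 2) ≤ 3 * Real.log (h a / h (a + n)) := by
  induction n with
  | zero => simp [div_self (hpos a).ne']
  | succ n ih =>
    rw [show a + (n + 1) = a + n + 1 by ring, sum_Ico_succ_top (by omega)]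
    have hstep := three_log_ratio_le hpos hanti (a + n)
    have e : Real.log (h a / h (a + n + 1)) = Real.log (h a / h (a + n)) - Real.log (h (a + n + 1) / h (a + n)) := by
      rw [Real.log_div (hpos _).ne' (hpos _).ne', Real.log_div (hpos _).ne' (hpos _).ne', Real.log_div (hpos _).ne' (hpos _).ne']; ring
    rw [e]; linarith

/-! ## §2 The B-form from the additive budget -/

/-- **THE B-FORM OF (★h°[gU]) FROM THE ADDITIVE B-BUDGET** (statement in the module docstring; `τlo ≥ 0` everywhere and `> 0` on the lags used, `gU ≥ 0`,
`0 ≤ r·gU₁ < 1`, `L_{k₂} ≥ 0`).  Proof: row by row `log(Pf(m+1+l',m+k₃)·ALa_j(m+1+l')) ≥ log q_{n₀} − Σ F (old floor) + Σ (3∕2)(y + y²∕2) (young decay,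
`cube_le_exp`) + log N_{l'} + mean over the lags used of (−Σ F + log τlo)` (AM–GM), then exponentiate. [folklore] -/
theorem geom_of_linear_budget {h F gU τlo q : ℕ → ℝ} {Pf ALa : ℕ → ℕ → ℝ} {Lq : ℝ} {k₂ k₃ m j : ℕ} {N : ℕ → ℕ}
    (hpos : ∀ n, 0 < h n) (hanti : Antitone h) (hF0 : ∀ t, 0 ≤ F t) (hgU0 : ∀ t, 0 ≤ gU t) (hτ0 : ∀ p, 0 ≤ τlo p)
    (hk3 : 1 ≤ k₃) (hLq : 0 ≤ Lq) (hq : ∀ n, q n = Lq * h (n + k₂) ^ 3 / 2)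
    (hPf : ∀ a b, Pf a b = (∏ t ∈ Ico a (b + 1), (1 + F t))⁻¹)
    (hALa : ∀ p, ALa j p = q p * ∑ l ∈ range k₂, if p + 1 + l ≤ j then Pf (p + 1 + l) (p + k₂) * τlo (p + 1 + l) else 0)
    (hN : ∀ l' ∈ range k₃, 1 ≤ N l' ∧ N l' ≤ k₂ ∧ m + 1 + l' + N l' ≤ j)
    (hτpos : ∀ l' ∈ range k₃, ∀ l ∈ range (N l'), 0 < τlo (m + 2 + l' + l))
    (hw0 : 0 ≤ (h (m + k₃ + 1) / h (m + k₃)) ^ 3 * gU (m + k₃ + 1)) (hw1 : (h (m + k₃ + 1) / h (m + k₃)) ^ 3 * gU (m + k₃ + 1) < 1)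
    (hbud : Real.log ((h (m + k₃ + 1) / h (m + k₃)) ^ 3 * gU (m + k₃ + 1)) +
        Real.log (∑ l ∈ range k₂, if m + 2 + k₃ + l ≤ j then ∏ t ∈ Ico (m + 1 + k₃ + 1 + l) (m + 1 + k₃ + k₂ + 1), gU t else 0) ≤
      Real.log (k₃ * (1 - (h (m + k₃ + 1) / h (m + k₃)) ^ 3 * gU (m + k₃ + 1))) +
        (∑ l' ∈ range k₃, (-∑ t ∈ Ico (m + 1 + l') (m + k₃ + 1), F t
          + ∑ p ∈ Ico (m + 1 + l' + k₂) (m + 1 + k₃ + k₂), 3 / 2 * ((1 - (h (p + 1) / h p) ^ 2) + (1 - (h (p + 1) / h p) ^ 2) ^ 2 / 2)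
          + Real.log (N l') + (∑ l ∈ range (N l'), (-∑ t ∈ Ico (m + 2 + l' + l) (m + 1 + l' + k₂ + 1), F t + Real.log (τlo (m + 2 + l' + l)))) / N l')) / k₃) :
    (h (m + k₃ + 1) / h (m + k₃)) ^ 3 * gU (m + k₃ + 1) * q (m + 1 + k₃) *
        (∑ l ∈ range k₂, if m + 2 + k₃ + l ≤ j then ∏ t ∈ Ico (m + 1 + k₃ + 1 + l) (m + 1 + k₃ + k₂ + 1), gU t else 0) ≤
      (1 - (h (m + k₃ + 1) / h (m + k₃)) ^ 3 * gU (m + k₃ + 1)) *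
        ((k₃ : ℝ) * Real.exp ((∑ l' ∈ range k₃, Real.log (Pf (m + 1 + l') (m + k₃) * ALa j (m + 1 + l'))) / k₃)) := by
  set w : ℝ := (h (m + k₃ + 1) / h (m + k₃)) ^ 3 * gU (m + k₃ + 1) with hw
  set Y : ℝ := ∑ l ∈ range k₂, (if m + 2 + k₃ + l ≤ j then ∏ t ∈ Ico (m + 1 + k₃ + 1 + l) (m + 1 + k₃ + k₂ + 1), gU t else 0) with hY
  have hk30 : (0 : ℝ) < k₃ := by exact_mod_cast (show 0 < k₃ by omega)
  have hY0 : 0 ≤ Y := sum_nonneg fun l _ => by split_ifs <;> [exact prod_nonneg fun t _ => hgU0 t; exact le_rfl]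
  have hq0 : ∀ n, 0 ≤ q n := fun n => by rw [hq]; have := hpos (n + k₂); positivity
  have hPfpos : ∀ a b, 0 < Pf a b := fun a b => by rw [hPf]; exact inv_pos.mpr (prod_pos fun t _ => by linarith [hF0 t])
  have hRHS0 : 0 ≤ (1 - w) * ((k₃ : ℝ) * Real.exp ((∑ l' ∈ range k₃, Real.log (Pf (m + 1 + l') (m + k₃) * ALa j (m + 1 + l'))) / k₃)) :=
    mul_nonneg (by linarith) (by positivity)
  -- trivial cases: the left side vanishes
  rcases eq_or_lt_of_le (mul_nonneg (mul_nonneg hw0 (hq0 (m + 1 + k₃))) hY0) with hz | hLpos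
  · rw [← hz]; exact hRHS0
  have hw' : 0 < w := by
    rcases eq_or_lt_of_le hw0 with h0 | h0
    · exfalso; rw [← h0, zero_mul, zero_mul] at hLpos; exact lt_irrefl _ hLpos
    · exact h0
  have hqpos : 0 < q (m + 1 + k₃) := by
    rcases eq_or_lt_of_le (hq0 (m + 1 + k₃)) with h0 | h0
    · exfalso; rw [← h0, mul_zero, zero_mul] at hLpos; exact lt_irrefl _ hLpos
    · exact h0
  have hYpos : 0 < Y := by
    rcases eq_or_lt_of_le hY0 with h0 | h0
    · exfalso; rw [← h0, mul_zero] at hLpos; exact lt_irrefl _ hLpos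
    · exact h0
  have hLq' : 0 < Lq := by
    rcases eq_or_lt_of_le hLq with h0 | h0
    · exfalso; rw [hq, ← h0, zero_mul, zero_div] at hqpos; exact lt_irrefl _ hqpos
    · exact h0
  have hqp : ∀ n, 0 < q n := fun n => by rw [hq]; have := hpos (n + k₂); positivity
  -- the young decay: log q_p − log q_{n₀} ≥ the credits on [p+k₂, n₀+k₂)
  have hdecay : ∀ l' ∈ range k₃, ∑ p ∈ Ico (m + 1 + l' + k₂) (m + 1 + k₃ + k₂), 3 / 2 * ((1 - (h (p + 1) / h p) ^ 2) + (1 - (h (p + 1) / h p) ^ 2) ^ 2 / 2)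
      ≤ Real.log (q (m + 1 + l')) - Real.log (q (m + 1 + k₃)) := by
    intro l' hl'
    have hl'k := mem_range.mp hl'
    have h1 := log_ratio_cube_ge hpos hanti (m + 1 + l' + k₂) (k₃ - l')
    rw [show m + 1 + l' + k₂ + (k₃ - l') = m + 1 + k₃ + k₂ by omega] at h1
    have e : Real.log (q (m + 1 + l')) - Real.log (q (m + 1 + k₃)) = 3 * Real.log (h (m + 1 + l' + k₂) / h (m + 1 + k₃ + k₂)) := by
      rw [← Real.log_div (hqp _).ne' (hqp _).ne', hq, hq]
      have e3 : Lq * h (m + 1 + l' + k₂) ^ 3 / 2 / (Lq * h (m + 1 + k₃ + k₂) ^ 3 / 2) = (h (m + 1 + l' + k₂) / h (m + 1 + k₃ + k₂)) ^ 3 := by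
        have := hpos (m + 1 + k₃ + k₂); rw [div_pow]; field_simp
      rw [e3, Real.log_pow]; norm_num
    linarith
  -- the rows
  have hrow : ∀ l' ∈ range k₃, Real.log (q (m + 1 + k₃)) + (-∑ t ∈ Ico (m + 1 + l') (m + k₃ + 1), F t
        + ∑ p ∈ Ico (m + 1 + l' + k₂) (m + 1 + k₃ + k₂), 3 / 2 * ((1 - (h (p + 1) / h p) ^ 2) + (1 - (h (p + 1) / h p) ^ 2) ^ 2 / 2)
        + Real.log (N l') + (∑ l ∈ range (N l'), (-∑ t ∈ Ico (m + 2 + l' + l) (m + 1 + l' + k₂ + 1), F t + Real.log (τlo (m + 2 + l' + l)))) / N l')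
      ≤ Real.log (Pf (m + 1 + l') (m + k₃) * ALa j (m + 1 + l')) := by
    intro l' hl'
    obtain ⟨hN1, hNk, hNj⟩ := hN l' hl'
    set p : ℕ := m + 1 + l' with hp
    -- the lags used, each positive
    set x : ℕ → ℝ := fun l => Pf (p + 1 + l) (p + k₂) * τlo (p + 1 + l) with hx
    have hxpos : ∀ l ∈ range (N l'), 0 < x l := fun l hl => by
      have := hτpos l' hl' l hl
      rw [show m + 2 + l' + l = p + 1 + l by omega] at this
      exact mul_pos (hPfpos _ _) this
    have hsub : ∑ l ∈ range (N l'), x l ≤ ∑ l ∈ range k₂, (if p + 1 + l ≤ j then Pf (p + 1 + l) (p + k₂) * τlo (p + 1 + l) else 0) := by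
      have h1 : ∑ l ∈ range (N l'), x l = ∑ l ∈ range (N l'), (if p + 1 + l ≤ j then Pf (p + 1 + l) (p + k₂) * τlo (p + 1 + l) else 0) :=
        sum_congr rfl fun l hl => by have := mem_range.mp hl; rw [if_pos (by omega)]
      rw [h1]
      exact sum_le_sum_of_subset_of_nonneg (range_mono hNk) fun l _ _ => by
        split_ifs <;> [exact mul_nonneg (hPfpos _ _).le (hτ0 _); exact le_rfl]
    have hSpos : 0 < ∑ l ∈ range (N l'), x l := sum_pos hxpos (by rw [nonempty_range_iff]; omega)
    -- AM–GM over the lags used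
    have hamgm := log_card_add_mean_log_le hN1 hxpos
    have hlogx : ∀ l ∈ range (N l'), -∑ t ∈ Ico (m + 2 + l' + l) (m + 1 + l' + k₂ + 1), F t + Real.log (τlo (m + 2 + l' + l)) ≤ Real.log (x l) := by
      intro l hl
      have hτ := hτpos l' hl' l hl
      rw [hx]; dsimp only
      rw [Real.log_mul (hPfpos _ _).ne' (by rw [show p + 1 + l = m + 2 + l' + l by omega]; exact hτ.ne'), hPf,
        show p + 1 + l = m + 2 + l' + l by omega, show p + k₂ + 1 = m + 1 + l' + k₂ + 1 by omega]
      linarith [log_inv_prod_ge hF0 (Ico (m + 2 + l' + l) (m + 1 + l' + k₂ + 1))]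
    have hmean : (∑ l ∈ range (N l'), (-∑ t ∈ Ico (m + 2 + l' + l) (m + 1 + l' + k₂ + 1), F t + Real.log (τlo (m + 2 + l' + l)))) / N l'
        ≤ (∑ l ∈ range (N l'), Real.log (x l)) / N l' :=
      div_le_div_of_nonneg_right (sum_le_sum hlogx) (by positivity)
    -- assemble the row
    have hA : Real.log (ALa j p) ≥ Real.log (q p) + Real.log (∑ l ∈ range (N l'), x l) := by
      rw [hALa, Real.log_mul (hqp p).ne' (by linarith)]
      linarith [Real.log_le_log hSpos hsub]
    have hT : Real.log (Pf (m + 1 + l') (m + k₃) * ALa j p) = Real.log (Pf (m + 1 + l') (m + k₃)) + Real.log (ALa j p) :=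
      Real.log_mul (hPfpos _ _).ne' (by
        have : 0 < ALa j p := by rw [hALa]; exact mul_pos (hqp p) (by linarith)
        exact this.ne')
    have hfl : -∑ t ∈ Ico (m + 1 + l') (m + k₃ + 1), F t ≤ Real.log (Pf (m + 1 + l') (m + k₃)) := by rw [hPf]; exact log_inv_prod_ge hF0 _
    have hd := hdecay l' hl'
    rw [hT]
    linarith
  -- sum the rows, divide by k₃
  have hsum := sum_le_sum hrow
  rw [sum_add_distrib, sum_const, card_range, nsmul_eq_mul] at hsum
  have hmeanT : Real.log (q (m + 1 + k₃)) + (∑ l' ∈ range k₃, (-∑ t ∈ Ico (m + 1 + l') (m + k₃ + 1), F t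
        + ∑ p ∈ Ico (m + 1 + l' + k₂) (m + 1 + k₃ + k₂), 3 / 2 * ((1 - (h (p + 1) / h p) ^ 2) + (1 - (h (p + 1) / h p) ^ 2) ^ 2 / 2)
        + Real.log (N l') + (∑ l ∈ range (N l'), (-∑ t ∈ Ico (m + 2 + l' + l) (m + 1 + l' + k₂ + 1), F t + Real.log (τlo (m + 2 + l' + l)))) / N l')) / k₃
      ≤ (∑ l' ∈ range k₃, Real.log (Pf (m + 1 + l') (m + k₃) * ALa j (m + 1 + l'))) / k₃ := by
    have := div_le_div_of_nonneg_right hsum hk30.le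
    rwa [add_div, mul_div_cancel_left₀ _ hk30.ne'] at this
  -- exponentiate: log LHS ≤ log RHS
  have h1w : 0 < 1 - w := by linarith
  have hlogL : Real.log (w * q (m + 1 + k₃) * Y) = Real.log w + Real.log (q (m + 1 + k₃)) + Real.log Y := by
    rw [Real.log_mul (mul_pos hw' hqpos).ne' hYpos.ne', Real.log_mul hw'.ne' hqpos.ne']
  have hlogR : Real.log ((1 - w) * ((k₃ : ℝ) * Real.exp ((∑ l' ∈ range k₃, Real.log (Pf (m + 1 + l') (m + k₃) * ALa j (m + 1 + l'))) / k₃))) =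
      Real.log (k₃ * (1 - w)) + (∑ l' ∈ range k₃, Real.log (Pf (m + 1 + l') (m + k₃) * ALa j (m + 1 + l'))) / k₃ := by
    rw [Real.log_mul h1w.ne' (by positivity), Real.log_mul hk30.ne' (Real.exp_pos _).ne', Real.log_exp, Real.log_mul hk30.ne' h1w.ne']; ring
  have hle : Real.log (w * q (m + 1 + k₃) * Y) ≤
      Real.log ((1 - w) * ((k₃ : ℝ) * Real.exp ((∑ l' ∈ range k₃, Real.log (Pf (m + 1 + l') (m + k₃) * ALa j (m + 1 + l'))) / k₃))) := by
    rw [hlogL, hlogR]; linarith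
  exact (Real.log_le_log_iff hLpos (mul_pos h1w (by positivity))).mp hle

end Summit.QuantumFields.BalabanUV.Beta.EriceRemainderEnclosureHistoryAutonomyComparisonAgeCompositionThreeAgesDefectGeomBudget

end
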